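import Literature.MathematicalPhysics.QuantumLattice.GrassmannGaussianAddition
import HarnessLib

/-!
# Dimock, *Quantum electrodynamics on the 3-torus I*, Appendix C «spacetime split», LEMMA 24 with (324)–(326) —
# fermionic conditional integration over the variables of a region `Λ ⊂ S`:
# `∫ H(Ψ̄_{Λᶜ},Ψ_{Λᶜ}) F(Ψ̄,Ψ) e^{−(Ψ̄,TΨ)} dΨ̄dΨ = ∫ H(Ψ̄_{Λᶜ},Ψ_{Λᶜ}) F̃(Ψ̄_{Λᶜ},Ψ_{Λᶜ}) e^{−(Ψ̄,TΨ)} dΨ̄dΨ` — PROVED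

statement-level skeleton of published theorems with citation tags; proofs where landed; nothing here is a claim about the Yang–Mills mass gap

**Citation header (reproduction of PUBLISHED work).** J. Dimock, *Quantum electrodynamics on the 3-torus. I. First
step*, arXiv:math-ph/0210020 (2002) [Dimock2002QED3TorusI], **Appendix C** «spacetime split», p.65 L62 – p.66 L26 of
the arXiv-v1 text layer `paper:arxiv-math-ph_0210020` (`p.NN Lnn` = PDF page ∕ text-layer line). Writer seat p11
(literature-prover-lit-balaban-p11-g16-0), YM LIT SWEEP item (c) D12; companion of the Appendix B files
`QED3FermionNorm.lean`, `QED3GaussianIntegralBound.lean`, `QED3FermionPartialIntegral.lean` (seat p11 gen 15).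

**The printed text.** p.65 L1–5: *"Let `S` be a finite set (e.g. one of our tori) and let `Λ` be a subset (e.g. a
small field region). Suppose we have a Gaussian integral on `R^S` defined by a positive self-adjoint operator `T` on
`R^S`. We want to carry out the integral over `R^Λ` first."* (LEMMA 23 = the bosonic statement (320)–(323), not in this
file.) p.65 L62–64: *"The above result is for bosons. For fermions suppose we have Grassman variables `Ψ̄, Ψ` indexed
by `S` and a Gaussian measure determined by an operator `T` on `R^S`. We assume that `T_Λ = χ_Λ T χ_Λ` is
non-singular."* **LEMMA 24** (p.65 L65–79, (324)):
`∫ H(Ψ̄_{Λᶜ},Ψ_{Λᶜ}) F(Ψ̄,Ψ) exp(−(Ψ̄,TΨ)) dΨ̄dΨ = ∫ H(Ψ̄_{Λᶜ},Ψ_{Λᶜ}) F̃(Ψ̄_{Λᶜ},Ψ_{Λᶜ}) exp(−(Ψ̄,TΨ)) dΨ̄dΨ`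
*"where `F̃(Ψ̄_{Λᶜ},Ψ_{Λᶜ}) = ∫ F(Ψ̄,Ψ) dμ_{Γ_Λ,β_Λ,β̄_Λ}(Ψ̄_Λ,Ψ_Λ)` (325) is the Gaussian integral over `Ψ̄_Λ, Ψ_Λ`
with covariance `Γ_Λ = T_Λ⁻¹` and mean `β_Λ = −T_Λ⁻¹ T_{ΛΛᶜ} Ψ_{Λᶜ}` and `β̄_Λ = −(T_Λ⁻¹)ᵀ (T_{ΛᶜΛ})ᵀ Ψ̄_{Λᶜ}`.
Proof. Follow the proof of the previous lemma. The transformation is now `Ψ_Λ → Ψ_Λ + β_Λ` and `Ψ̄_Λ → Ψ̄_Λ + β̄_Λ`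
and the Gaussian integral is identified/defined as
`F̃(Ψ̄_{Λᶜ},Ψ_{Λᶜ}) = ∫ F(Ψ̄ + β̄_Λ, Ψ + β_Λ) exp(−(Ψ̄,T_ΛΨ)) dΨ̄_ΛdΨ_Λ ∕ ∫ exp(−(Ψ̄,T_ΛΨ)) dΨ̄_ΛdΨ_Λ` (326).
The denominator is non-zero by the assumption that `T_Λ` is non-singular."* (p.66 L1–26). The proof of *"the
previous lemma"* that is being followed (p.65 L36–61): *"In `(A,TA)` we write `T = T_{Λᶜ} + T_{ΛᶜΛ} + T_{ΛΛᶜ} + T_Λ`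
… The cross terms are eliminated by the transformation `A_Λ → A_Λ + α_Λ` … where
`R_{Λᶜ} = T_{Λᶜ} − T_{ΛᶜΛ} T_Λ⁻¹ T_{ΛΛᶜ}`. If we divide by `∫exp(−(Φ,T_ΛΦ))dΦ_Λ` the term in parentheses is
identified as `F̃(A_{Λᶜ})` … Now reverse the first step."*

**What is here (everything PROVED, no named facts, no `sorry`).** The Grassmann variables and the Berezin integral
are the tree's (`QuantumLattice.GrassmannAlgebra R J`, `gen`, `berezin`, partial integration `berezinOn`,
`grassmannExp`, `quadratic R A = Σ Aᵢⱼ ψ̄ᵢψⱼ`). The finite index set is split as `S = Λ ⊔ Λᶜ` with `Λ ≙ κ`,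
`Λᶜ ≙ κ'`; the operator `T` on `R^S` is a matrix `T : Matrix (κ ⊕ κ') (κ ⊕ κ') R` whose blocks
`T.toBlocks₁₁ = T_Λ = χ_ΛTχ_Λ`, `T.toBlocks₁₂ = T_{ΛΛᶜ}`, `T.toBlocks₂₁ = T_{ΛᶜΛ}`, `T.toBlocks₂₂ = T_{Λᶜ}` are the
printed ones (`Matrix.fromBlocks_toBlocks`). Following the tree's idiom for fermion families
(`GrassmannGaussianSources.lean`, `GrassmannGaussianAddition.lean`), the variables `Ψ̄_Λ, Ψ_Λ` resp.
`Ψ̄_{Λᶜ}, Ψ_{Λᶜ}` are generators of ONE Grassmann algebra on a finite linearly ordered `J`, placed by order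
embeddings `e₁ : κ ⊕ₗ κ ↪o J`, `e₂ : κ' ⊕ₗ κ' ↪o J` with disjoint ranges (`ψ̄` = `inl`, `ψ` = `inr`, as in the tree's
`psiBar`∕`psi`); generators of `J` outside both ranges, if any, are inert spectators.
* `fieldBar`, `field` — `Ψ̄(x)`, `Ψ(x)`, `x ∈ S = κ ⊕ κ'`; `pairing T = (Ψ̄, TΨ) = Σ_{x,y∈S} T(x,y) Ψ̄(x)Ψ(y)`;
  `varsΛ e₁` — the integrated variables `dΨ̄_Λ dΨ_Λ`;
* `meanShift` ∕ `shiftΛ` — *"the transformation `Ψ_Λ → Ψ_Λ + β_Λ` and `Ψ̄_Λ → Ψ̄_Λ + β̄_Λ`"* as the substitution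
  endomorphism `ExteriorAlgebra.map (1 + N)` of the tree's `IsSpectatorShift` kind (`isSpectatorShift_meanShift`),
  with the printed means: `shiftΛ_field_inl` (`Ψ_Λ(j) ↦ Ψ_Λ(j) − Σ_l (T_Λ⁻¹T_{ΛΛᶜ})_{jl} Ψ_{Λᶜ}(l)`),
  `shiftΛ_fieldBar_inl` (`Ψ̄_Λ(i) ↦ Ψ̄_Λ(i) − Σ_l (T_{ΛᶜΛ}T_Λ⁻¹)_{li} Ψ̄_{Λᶜ}(l)`, i.e. `+β̄_Λ` with
  `β̄_Λ = −(T_Λ⁻¹)ᵀ(T_{ΛᶜΛ})ᵀΨ̄_{Λᶜ}`), `shiftΛ_field_inr` ∕ `shiftΛ_fieldBar_inr` (the `Λᶜ` fields are fixed);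
* `shiftΛ_pairing` — **the cross terms are eliminated**:
  `(Ψ̄,TΨ) ∘ shift = (Ψ̄_Λ, T_ΛΨ_Λ) + (Ψ̄_{Λᶜ}, R_{Λᶜ}Ψ_{Λᶜ})`, `R_{Λᶜ} = T_{Λᶜ} − T_{ΛᶜΛ}T_Λ⁻¹T_{ΛΛᶜ}`
  (`schur T`), proved through the block identity
  `(1 0; −T_{ΛᶜΛ}T_Λ⁻¹ 1) · T · (1 −T_Λ⁻¹T_{ΛΛᶜ}; 0 1) = (T_Λ 0; 0 R_{Λᶜ})` (`fromBlocks_conj_eq`);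
* `weightΛ e₁ T_Λ = exp(−(Ψ̄,T_ΛΨ))`, `gaussNormΛ T_Λ = ∫ exp(−(Ψ̄,T_ΛΨ)) dΨ̄_ΛdΨ_Λ` (the denominator of (326), a
  scalar) with `berezinOn_varsΛ_weightΛ` (`∫ dΨ̄_ΛdΨ_Λ exp(−(Ψ̄,T_ΛΨ)) = gaussNormΛ · 1` in the big algebra),
  `gaussNormΛ_eq` (`= (−1)^{n(n−1)/2} det(−T_Λ) = (−1)^{n(n+1)/2} det T_Λ`, `n = |Λ|`, the tree's orientation
  `berezin_grassmannExp_quadratic`)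
  and `isUnit_gaussNormΛ_iff` — *"the denominator is non-zero by the assumption that `T_Λ` is non-singular"*;
* `condExp T F = F̃` DEFINED BY (326): `(gaussNormΛ T_Λ)⁻¹ • ∫ dΨ̄_ΛdΨ_Λ [F(Ψ̄ + β̄_Λ, Ψ + β_Λ) · exp(−(Ψ̄,T_ΛΨ))]`,
  with `condExp_mem_spectatorSubalgebra` (`F̃ = F̃(Ψ̄_{Λᶜ},Ψ_{Λᶜ})`), linearity `condExp_add` ∕ `condExp_smul`,
  `condExp_spectator_mul` (`(HF)~ = H F̃` for `H = H(Ψ̄_{Λᶜ},Ψ_{Λᶜ})` — the Remark *"`F̃` is the conditional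
  expectation of `F` with respect to the variables `Λᶜ`"*), `condExp_one` (`1̃ = 1`);
* **LEMMA 24**: `berezinOn_varsΛ_mul_condExp` — already the `dΨ̄_ΛdΨ_Λ` integrals of the two sides of (324) agree
  (an identity in the algebra of the `Λᶜ` fields); `berezinOn_mul_condExp` — hence the integrals over any set of
  variables containing `Λ`'s; **`berezin_mul_condExp` — (324) as printed** (`∫ dΨ̄dΨ` over all variables).
The proof is the printed one: translation invariance of `∫ dΨ̄_ΛdΨ_Λ` under the shift (the tree's
`IsSpectatorShift.berezinOn_map`, Salmhofer's Lemma B.1), the factorisation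
`e^{−(Ψ̄,TΨ)∘shift} = e^{−(Ψ̄,T_ΛΨ)} e^{−(Ψ̄_{Λᶜ},R_{Λᶜ}Ψ_{Λᶜ})}` with the second factor a central spectator, linearity
of `∫ dΨ̄_ΛdΨ_Λ` over spectators (`berezinOn_mul_of_mem_spectatorSubalgebra`), and
`∫ dΨ̄_ΛdΨ_Λ e^{−(Ψ̄,T_ΛΨ)} = gaussNormΛ` transported along `e₁` (`berezinOn_map_extendByZero`,
`berezin_grassmannExp_quadratic_holds`). Scalars: any commutative `ℚ`-algebra `R` (the paper: `ℝ` ∕ `ℂ`). Not here: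
LEMMA 23 (bosons), (325) as a statement about a Grassmann Gaussian "measure with mean" beyond its printed
definition (326), LEMMA 25.
-/

noncomputable section

open Finset

namespace Literature.MathematicalPhysics.QuantumFieldTheory.Dimock2011to13

namespace QED3TorusI

namespace SpacetimeSplit

open Literature.MathematicalPhysics.QuantumLattice
open Literature.MathematicalPhysics.QuantumLattice.GrassmannAlgebra
open ExteriorAlgebra
open scoped Matrix

variable (R : Type*) [CommRing R] {κ : Type*} [LinearOrder κ] [Fintype κ]
  {κ' : Type*} [LinearOrder κ'] [Fintype κ'] {J : Type*} [LinearOrder J] [Fintype J]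

/-! ## The fields on `S = Λ ⊔ Λᶜ`, the bilinear `(Ψ̄, TΨ)`, the `Λ`-variables -/

/-- The generator index of `Ψ̄(x)`, `x ∈ S = Λ ⊔ Λᶜ` (`Λ ≙ κ` placed by `e₁`, `Λᶜ ≙ κ'` placed by `e₂`; `ψ̄ = inl`).
[cite: Dimock2002QED3TorusI, App. C p.65 L62–63 («Grassman variables Ψ̄, Ψ indexed by S»)] -/
def idxBar (e₁ : κ ⊕ₗ κ ↪o J) (e₂ : κ' ⊕ₗ κ' ↪o J) : κ ⊕ κ' → J :=
  Sum.elim (fun i => e₁ (toLex (Sum.inl i))) fun i => e₂ (toLex (Sum.inl i))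

/-- The generator index of `Ψ(x)`, `x ∈ S = Λ ⊔ Λᶜ` (`ψ = inr`).
[cite: Dimock2002QED3TorusI, App. C p.65 L62–63] -/
def idx (e₁ : κ ⊕ₗ κ ↪o J) (e₂ : κ' ⊕ₗ κ' ↪o J) : κ ⊕ κ' → J :=
  Sum.elim (fun j => e₁ (toLex (Sum.inr j))) fun j => e₂ (toLex (Sum.inr j))

/-- The conjugate fields `Ψ̄(x)`, `x ∈ S = Λ ⊔ Λᶜ`. [cite: Dimock2002QED3TorusI, App. C p.65 L62–63] -/
def fieldBar (e₁ : κ ⊕ₗ κ ↪o J) (e₂ : κ' ⊕ₗ κ' ↪o J) (x : κ ⊕ κ') : GrassmannAlgebra R J :=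
  gen R (idxBar e₁ e₂ x)

/-- The fields `Ψ(x)`, `x ∈ S = Λ ⊔ Λᶜ`. [cite: Dimock2002QED3TorusI, App. C p.65 L62–63] -/
def field (e₁ : κ ⊕ₗ κ ↪o J) (e₂ : κ' ⊕ₗ κ' ↪o J) (x : κ ⊕ κ') : GrassmannAlgebra R J :=
  gen R (idx e₁ e₂ x)

/-- The fermionic bilinear `(Ψ̄, TΨ) = Σ_{x,y ∈ S} T(x,y) Ψ̄(x) Ψ(y)` of an operator `T` on `R^S`, `S = Λ ⊔ Λᶜ`.
[cite: Dimock2002QED3TorusI, App. C (324) p.65 L63–69] -/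
def pairing (e₁ : κ ⊕ₗ κ ↪o J) (e₂ : κ' ⊕ₗ κ' ↪o J) (T : Matrix (κ ⊕ κ') (κ ⊕ κ') R) :
    GrassmannAlgebra R J :=
  ∑ x, ∑ y, T x y • (fieldBar R e₁ e₂ x * field R e₁ e₂ y)

variable {R} in
/-- The integrated variables `dΨ̄_Λ dΨ_Λ`: all generators of the `Λ`-family.
[cite: Dimock2002QED3TorusI, App. C (326) p.66 L13–24] -/
def varsΛ (e₁ : κ ⊕ₗ κ ↪o J) : Finset J :=
  Finset.univ.map e₁.toEmbedding

/-- The Schur complement `R_{Λᶜ} = T_{Λᶜ} − T_{ΛᶜΛ} T_Λ⁻¹ T_{ΛΛᶜ}`.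
[cite: Dimock2002QED3TorusI, App. C p.65 L52–53 («where R_{Λᶜ} = T_{Λᶜ} − T_{ΛᶜΛ}T_Λ⁻¹T_{ΛΛᶜ}»)] -/
def schur (T : Matrix (κ ⊕ κ') (κ ⊕ κ') R) : Matrix κ' κ' R :=
  T.toBlocks₂₂ - T.toBlocks₂₁ * T.toBlocks₁₁⁻¹ * T.toBlocks₁₂

section Basic

variable (e₁ : κ ⊕ₗ κ ↪o J) (e₂ : κ' ⊕ₗ κ' ↪o J)

omit [Fintype κ] [Fintype κ'] [Fintype J] in
/-- `Ψ̄(x)` for `x ∈ Λ` is the `ψ̄`-generator of the `Λ`-family. [cite: Dimock2002QED3TorusI, App. C p.65 L62–64] -/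
theorem fieldBar_inl (i : κ) : fieldBar R e₁ e₂ (Sum.inl i) = gen R (e₁ (toLex (Sum.inl i))) := rfl

omit [Fintype κ] [Fintype κ'] [Fintype J] in
/-- `Ψ̄(x)` for `x ∈ Λᶜ` is the `ψ̄`-generator of the `Λᶜ`-family. [cite: Dimock2002QED3TorusI, App. C p.65 L62–64] -/
theorem fieldBar_inr (i : κ') : fieldBar R e₁ e₂ (Sum.inr i) = gen R (e₂ (toLex (Sum.inl i))) := rfl

omit [Fintype κ] [Fintype κ'] [Fintype J] in
/-- `Ψ(x)` for `x ∈ Λ` is the `ψ`-generator of the `Λ`-family. [cite: Dimock2002QED3TorusI, App. C p.65 L62–64] -/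
theorem field_inl (j : κ) : field R e₁ e₂ (Sum.inl j) = gen R (e₁ (toLex (Sum.inr j))) := rfl

omit [Fintype κ] [Fintype κ'] [Fintype J] in
/-- `Ψ(x)` for `x ∈ Λᶜ` is the `ψ`-generator of the `Λᶜ`-family. [cite: Dimock2002QED3TorusI, App. C p.65 L62–64] -/
theorem field_inr (j : κ') : field R e₁ e₂ (Sum.inr j) = gen R (e₂ (toLex (Sum.inr j))) := rfl

omit [Fintype J] in
/-- Membership in the `Λ`-variables `dΨ̄_Λ dΨ_Λ`. [cite: Dimock2002QED3TorusI, App. C (326) p.66 L19] -/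
theorem mem_varsΛ_iff {x : J} : x ∈ varsΛ e₁ ↔ ∃ k, e₁ k = x := by
  simp only [varsΛ, Finset.mem_map, Finset.mem_univ, true_and, RelEmbedding.coe_toEmbedding]

omit [Fintype J] in
/-- `(Ψ̄, TΨ)` in block form: `T = (T_Λ T_{ΛΛᶜ}; T_{ΛᶜΛ} T_{Λᶜ})`.
[cite: Dimock2002QED3TorusI, App. C p.65 L36–37 («we write T = T_{Λᶜ} + T_{ΛᶜΛ} + T_{ΛΛᶜ} + T_Λ»)] -/
theorem pairing_eq_blocks (T : Matrix (κ ⊕ κ') (κ ⊕ κ') R) :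
    pairing R e₁ e₂ T =
      ∑ i, ∑ j, T.toBlocks₁₁ i j • (fieldBar R e₁ e₂ (Sum.inl i) * field R e₁ e₂ (Sum.inl j)) +
      ∑ i, ∑ j, T.toBlocks₁₂ i j • (fieldBar R e₁ e₂ (Sum.inl i) * field R e₁ e₂ (Sum.inr j)) +
      ∑ i, ∑ j, T.toBlocks₂₁ i j • (fieldBar R e₁ e₂ (Sum.inr i) * field R e₁ e₂ (Sum.inl j)) +
      ∑ i, ∑ j, T.toBlocks₂₂ i j • (fieldBar R e₁ e₂ (Sum.inr i) * field R e₁ e₂ (Sum.inr j)) := by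
  simp only [pairing, Fintype.sum_sum_type, Finset.sum_add_distrib, Matrix.toBlocks₁₁, Matrix.toBlocks₁₂,
    Matrix.toBlocks₂₁, Matrix.toBlocks₂₂, Matrix.of_apply]
  abel

omit [Fintype J] in
/-- `(Ψ̄, TΨ)` for a block-diagonal `T = (A 0; 0 D)` is `(Ψ̄_Λ, AΨ_Λ) + (Ψ̄_{Λᶜ}, DΨ_{Λᶜ})` (no cross terms).
[cite: Dimock2002QED3TorusI, App. C p.65 L36–41] -/
theorem pairing_fromBlocks_diag (A : Matrix κ κ R) (D : Matrix κ' κ' R) :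
    pairing R e₁ e₂ (Matrix.fromBlocks A 0 0 D) =
      ∑ i, ∑ j, A i j • (fieldBar R e₁ e₂ (Sum.inl i) * field R e₁ e₂ (Sum.inl j)) +
      ∑ i, ∑ j, D i j • (fieldBar R e₁ e₂ (Sum.inr i) * field R e₁ e₂ (Sum.inr j)) := by
  rw [pairing_eq_blocks]
  simp only [Matrix.toBlocks_fromBlocks₁₁, Matrix.toBlocks_fromBlocks₁₂, Matrix.toBlocks_fromBlocks₂₁,
    Matrix.toBlocks_fromBlocks₂₂, Matrix.zero_apply, zero_smul, Finset.sum_const_zero, add_zero]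

omit [Fintype κ'] [Fintype J] in
/-- The `Λ`-block of `(Ψ̄, TΨ)` is the tree's `quadratic` transported along `e₁`:
`(Ψ̄, T_ΛΨ) = Σ_{i,j∈Λ} (T_Λ)ᵢⱼ Ψ̄_Λ(i)Ψ_Λ(j) = e₁_*(ψ̄ T_Λ ψ)`. [cite: Dimock2002QED3TorusI, App. C (326) p.66 L15–18] -/
theorem sum_sum_toBlocks₁₁_eq_map_quadratic (A : Matrix κ κ R) :
    ∑ i, ∑ j, A i j • (fieldBar R e₁ e₂ (Sum.inl i) * field R e₁ e₂ (Sum.inl j)) =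
      ExteriorAlgebra.map (Function.ExtendByZero.linearMap R e₁) (quadratic R A) := by
  simp only [quadratic, map_sum, map_smul, map_mul, psiBar, psi, map_extendByZero_gen', fieldBar_inl, field_inl]

omit [Fintype J] in
/-- `(Ψ̄, TΨ)` is nilpotent (no constant term), so `exp(−(Ψ̄,TΨ))` is a finite sum.
[cite: Dimock2002QED3TorusI, App. C (324) p.65 L67–70] -/
theorem isNilpotent_pairing (T : Matrix (κ ⊕ κ') (κ ⊕ κ') R) : IsNilpotent (pairing R e₁ e₂ T) :=
  isNilpotent_sum_sum_smul_ι_mul_ι T (fun x => (Pi.single (idxBar e₁ e₂ x) (1 : R) : J → R))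
    fun y => (Pi.single (idx e₁ e₂ y) (1 : R) : J → R)

omit [Fintype J] in
/-- `(Ψ̄, TΨ)` is central (even). [cite: Dimock2002QED3TorusI, App. C (324) p.65 L67–70] -/
theorem commute_pairing (T : Matrix (κ ⊕ κ') (κ ⊕ κ') R) (z : GrassmannAlgebra R J) :
    Commute (pairing R e₁ e₂ T) z :=
  commute_sum_sum_smul_ι_mul_ι T (fun x => (Pi.single (idxBar e₁ e₂ x) (1 : R) : J → R))
    (fun y => (Pi.single (idx e₁ e₂ y) (1 : R) : J → R)) z

omit [Fintype κ] [Fintype J] in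
/-- A `ΛᶜΛᶜ` bilinear `(Ψ̄_{Λᶜ}, DΨ_{Λᶜ}) = Σ Dᵢⱼ Ψ̄_{Λᶜ}(i)Ψ_{Λᶜ}(j)` (such as `(A, R_{Λᶜ}A)` of (322)) is nilpotent …
[cite: Dimock2002QED3TorusI, App. C (322) p.65 L42–53] -/
theorem isNilpotent_sum_sum_inr (D : Matrix κ' κ' R) :
    IsNilpotent (∑ i, ∑ j, D i j • (fieldBar R e₁ e₂ (Sum.inr i) * field R e₁ e₂ (Sum.inr j))) :=
  isNilpotent_sum_sum_smul_ι_mul_ι D (fun i => (Pi.single (e₂ (toLex (Sum.inl i))) (1 : R) : J → R))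
    fun j => (Pi.single (e₂ (toLex (Sum.inr j))) (1 : R) : J → R)

omit [Fintype κ] [Fintype J] in
/-- … and central. [cite: Dimock2002QED3TorusI, App. C (322) p.65 L42–53] -/
theorem commute_sum_sum_inr (D : Matrix κ' κ' R) (z : GrassmannAlgebra R J) :
    Commute (∑ i, ∑ j, D i j • (fieldBar R e₁ e₂ (Sum.inr i) * field R e₁ e₂ (Sum.inr j))) z :=
  commute_sum_sum_smul_ι_mul_ι D (fun i => (Pi.single (e₂ (toLex (Sum.inl i))) (1 : R) : J → R))
    (fun j => (Pi.single (e₂ (toLex (Sum.inr j))) (1 : R) : J → R)) z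

omit [Fintype κ'] in
/-- With disjoint ranges, the `Λᶜ` fields `Ψ̄_{Λᶜ}, Ψ_{Λᶜ}` are spectators of the `Λ`-variables (arguments of
`H(Ψ̄_{Λᶜ},Ψ_{Λᶜ})`). [cite: Dimock2002QED3TorusI, App. C (324) p.65 L65–67] -/
theorem gen_e₂_mem_spectatorSubalgebra (h12 : ∀ k k', e₁ k ≠ e₂ k') (k' : κ' ⊕ₗ κ') :
    gen R (e₂ k') ∈ spectatorSubalgebra R (varsΛ e₁) :=
  gen_mem_spectatorSubalgebra R fun h => by
    obtain ⟨k, hk⟩ := (mem_varsΛ_iff e₁).1 h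
    exact h12 k k' hk

/-- A `ΛᶜΛᶜ` bilinear is a spectator of the `Λ`-variables. [cite: Dimock2002QED3TorusI, App. C (322)–(324) p.65 L42–67] -/
theorem sum_sum_inr_mem_spectatorSubalgebra (h12 : ∀ k k', e₁ k ≠ e₂ k') (D : Matrix κ' κ' R) :
    ∑ i, ∑ j, D i j • (fieldBar R e₁ e₂ (Sum.inr i) * field R e₁ e₂ (Sum.inr j)) ∈
      spectatorSubalgebra R (varsΛ e₁) :=
  Subalgebra.sum_mem _ fun _ _ => Subalgebra.sum_mem _ fun _ _ => Subalgebra.smul_mem _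
    (Subalgebra.mul_mem _ (gen_e₂_mem_spectatorSubalgebra R e₁ e₂ h12 _)
      (gen_e₂_mem_spectatorSubalgebra R e₁ e₂ h12 _)) _

end Basic

/-! ## The transformation `Ψ_Λ → Ψ_Λ + β_Λ`, `Ψ̄_Λ → Ψ̄_Λ + β̄_Λ` -/

section Shift

variable (e₁ : κ ⊕ₗ κ ↪o J) (e₂ : κ' ⊕ₗ κ' ↪o J) (T : Matrix (κ ⊕ κ') (κ ⊕ κ') R)

/-- The coefficient vector of `β_Λ(j) = −Σ_l (T_Λ⁻¹T_{ΛΛᶜ})_{jl} Ψ_{Λᶜ}(l)` on the generator space.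
[cite: Dimock2002QED3TorusI, App. C (325) p.66 L6–9 («mean β_Λ = −T_Λ⁻¹T_{ΛΛᶜ}Ψ_{Λᶜ}»)] -/
def meanVec (j : κ) : J → R :=
  -∑ l, (T.toBlocks₁₁⁻¹ * T.toBlocks₁₂) j l • (Pi.single (e₂ (toLex (Sum.inr l))) (1 : R) : J → R)

/-- The coefficient vector of `β̄_Λ(i) = −Σ_l (T_{ΛᶜΛ}T_Λ⁻¹)_{li} Ψ̄_{Λᶜ}(l)`, i.e.
`β̄_Λ = −(T_Λ⁻¹)ᵀ(T_{ΛᶜΛ})ᵀΨ̄_{Λᶜ}`. [cite: Dimock2002QED3TorusI, App. C (325) p.66 L9–10] -/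
def meanBarVec (i : κ) : J → R :=
  -∑ l, (T.toBlocks₂₁ * T.toBlocks₁₁⁻¹) l i • (Pi.single (e₂ (toLex (Sum.inl l))) (1 : R) : J → R)

/-- The generator-space endomorphism `N` of the transformation `1 + N`: `e_{Ψ_Λ(j)} ↦ β_Λ(j)`,
`e_{Ψ̄_Λ(i)} ↦ β̄_Λ(i)`, all other generators killed.
[cite: Dimock2002QED3TorusI, App. C p.66 L11–12 («The transformation is now Ψ_Λ → Ψ_Λ + β_Λ and Ψ̄_Λ → Ψ̄_Λ + β̄_Λ»)] -/
def meanShift : Module.End R (J → R) :=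
  ∑ j, (LinearMap.proj (e₁ (toLex (Sum.inr j)))).smulRight (meanVec R e₂ T j) +
    ∑ i, (LinearMap.proj (e₁ (toLex (Sum.inl i)))).smulRight (meanBarVec R e₂ T i)

/-- The substitution `F(Ψ̄,Ψ) ↦ F(Ψ̄ + β̄_Λ, Ψ + β_Λ)` as an algebra endomorphism.
[cite: Dimock2002QED3TorusI, App. C (326) p.66 L11–15] -/
def shiftΛ : GrassmannAlgebra R J →ₐ[R] GrassmannAlgebra R J :=
  ExteriorAlgebra.map (1 + meanShift R e₁ e₂ T)

omit [Fintype J] in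
/-- Evaluation of the shift endomorphism. [folklore] -/
private theorem meanShift_apply (w : J → R) :
    meanShift R e₁ e₂ T w = ∑ j, w (e₁ (toLex (Sum.inr j))) • meanVec R e₂ T j +
      ∑ i, w (e₁ (toLex (Sum.inl i))) • meanBarVec R e₂ T i := by
  simp only [meanShift, LinearMap.add_apply, LinearMap.sum_apply, LinearMap.smulRight_apply,
    LinearMap.proj_apply]

omit [Fintype J] in
/-- `β_Λ` has no component along the `Λ`-variables. [folklore] -/
private theorem meanVec_apply_e₁ (h12 : ∀ k k', e₁ k ≠ e₂ k') (j : κ) (k : κ ⊕ₗ κ) : meanVec R e₂ T j (e₁ k) = 0 := by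
  simp only [meanVec, Pi.neg_apply, Finset.sum_apply, Pi.smul_apply,
    Pi.single_eq_of_ne (h12 k _), smul_zero, Finset.sum_const_zero, neg_zero]

omit [Fintype J] in
/-- `β̄_Λ` has no component along the `Λ`-variables. [folklore] -/
private theorem meanBarVec_apply_e₁ (h12 : ∀ k k', e₁ k ≠ e₂ k') (i : κ) (k : κ ⊕ₗ κ) :
    meanBarVec R e₂ T i (e₁ k) = 0 := by
  simp only [meanBarVec, Pi.neg_apply, Finset.sum_apply, Pi.smul_apply,
    Pi.single_eq_of_ne (h12 k _), smul_zero, Finset.sum_const_zero, neg_zero]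

omit [Fintype J] in
/-- The transformation is a shift of the `Λ`-variables by spectators (Salmhofer's `ψ ↦ ψ + Bη`, the tree's
`IsSpectatorShift`). [cite: Dimock2002QED3TorusI, App. C p.66 L11–12] -/
theorem isSpectatorShift_meanShift (h12 : ∀ k k', e₁ k ≠ e₂ k') :
    IsSpectatorShift R (varsΛ e₁) (meanShift R e₁ e₂ T) := by
  refine ⟨fun x hx => ?_, fun y x hx => ?_⟩
  · rw [meanShift_apply]
    have h1 : ∀ k, (Pi.single x (1 : R) : J → R) (e₁ k) = 0 := fun k =>
      Pi.single_eq_of_ne (fun h : e₁ k = x => hx ((mem_varsΛ_iff e₁).2 ⟨k, h⟩)) _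
    simp only [h1, zero_smul, Finset.sum_const_zero, add_zero]
  · obtain ⟨k, rfl⟩ := (mem_varsΛ_iff e₁).1 hx
    rw [meanShift_apply]
    simp only [Pi.add_apply, Finset.sum_apply, Pi.smul_apply, meanVec_apply_e₁ R e₁ e₂ T h12,
      meanBarVec_apply_e₁ R e₁ e₂ T h12, smul_zero, Finset.sum_const_zero, add_zero]

omit [Fintype J] in
/-- The shift endomorphism on the basis vector of `Ψ_Λ(j)`. [folklore] -/
private theorem meanShift_single_inr (j : κ) :
    meanShift R e₁ e₂ T (Pi.single (e₁ (toLex (Sum.inr j))) 1) = meanVec R e₂ T j := by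
  rw [meanShift_apply]
  have hinj' : ∀ a b : κ ⊕ₗ κ, (e₁ a = e₁ b) = (a = b) := fun a b => propext e₁.injective.eq_iff
  have h1 : ∀ i, (Pi.single (e₁ (toLex (Sum.inr j))) (1 : R) : J → R) (e₁ (toLex (Sum.inl i))) = 0 :=
    fun i => Pi.single_eq_of_ne (fun h => by cases e₁.injective h) _
  have h2 : ∀ j', (Pi.single (e₁ (toLex (Sum.inr j))) (1 : R) : J → R) (e₁ (toLex (Sum.inr j'))) =
      if j' = j then 1 else 0 := by
    intro j'
    simp only [Pi.single_apply, hinj', toLex_inj, Sum.inr.injEq]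
  simp only [h1, h2, zero_smul, Finset.sum_const_zero, add_zero, ite_smul, one_smul, zero_smul,
    Finset.sum_ite_eq', Finset.mem_univ, if_true]

omit [Fintype J] in
/-- The shift endomorphism on the basis vector of `Ψ̄_Λ(i)`. [folklore] -/
private theorem meanShift_single_inl (i : κ) :
    meanShift R e₁ e₂ T (Pi.single (e₁ (toLex (Sum.inl i))) 1) = meanBarVec R e₂ T i := by
  rw [meanShift_apply]
  have hinj' : ∀ a b : κ ⊕ₗ κ, (e₁ a = e₁ b) = (a = b) := fun a b => propext e₁.injective.eq_iff
  have h1 : ∀ j, (Pi.single (e₁ (toLex (Sum.inl i))) (1 : R) : J → R) (e₁ (toLex (Sum.inr j))) = 0 :=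
    fun j => Pi.single_eq_of_ne (fun h => by cases e₁.injective h) _
  have h2 : ∀ i', (Pi.single (e₁ (toLex (Sum.inl i))) (1 : R) : J → R) (e₁ (toLex (Sum.inl i'))) =
      if i' = i then 1 else 0 := by
    intro i'
    simp only [Pi.single_apply, hinj', toLex_inj, Sum.inl.injEq]
  simp only [h1, h2, zero_smul, Finset.sum_const_zero, zero_add, ite_smul, one_smul, zero_smul,
    Finset.sum_ite_eq', Finset.mem_univ, if_true]

omit [Fintype J] in
/-- `Ψ_Λ(j) ↦ Ψ_Λ(j) + β_Λ(j)`, `β_Λ = −T_Λ⁻¹T_{ΛΛᶜ}Ψ_{Λᶜ}`.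
[cite: Dimock2002QED3TorusI, App. C (325)–(326) p.66 L6–12] -/
theorem shiftΛ_field_inl (j : κ) :
    shiftΛ R e₁ e₂ T (field R e₁ e₂ (Sum.inl j)) =
      field R e₁ e₂ (Sum.inl j) - ∑ l, (T.toBlocks₁₁⁻¹ * T.toBlocks₁₂) j l • field R e₁ e₂ (Sum.inr l) := by
  rw [shiftΛ, field_inl, map_one_add_gen, meanShift_single_inr, meanVec, map_neg, map_sum]
  simp only [map_smul, field_inr, gen, sub_eq_add_neg]

omit [Fintype J] in
/-- `Ψ̄_Λ(i) ↦ Ψ̄_Λ(i) + β̄_Λ(i)`, `β̄_Λ = −(T_Λ⁻¹)ᵀ(T_{ΛᶜΛ})ᵀΨ̄_{Λᶜ}`.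
[cite: Dimock2002QED3TorusI, App. C (325)–(326) p.66 L9–12] -/
theorem shiftΛ_fieldBar_inl (i : κ) :
    shiftΛ R e₁ e₂ T (fieldBar R e₁ e₂ (Sum.inl i)) =
      fieldBar R e₁ e₂ (Sum.inl i) - ∑ l, (T.toBlocks₂₁ * T.toBlocks₁₁⁻¹) l i • fieldBar R e₁ e₂ (Sum.inr l) := by
  rw [shiftΛ, fieldBar_inl, map_one_add_gen, meanShift_single_inl, meanBarVec, map_neg, map_sum]
  simp only [map_smul, fieldBar_inr, gen, sub_eq_add_neg]

/-- The `Λᶜ` fields are fixed: `Ψ_{Λᶜ}(j) ↦ Ψ_{Λᶜ}(j)`. [cite: Dimock2002QED3TorusI, App. C p.66 L11–12] -/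
theorem shiftΛ_field_inr (h12 : ∀ k k', e₁ k ≠ e₂ k') (j : κ') :
    shiftΛ R e₁ e₂ T (field R e₁ e₂ (Sum.inr j)) = field R e₁ e₂ (Sum.inr j) :=
  (isSpectatorShift_meanShift R e₁ e₂ T h12).map_eq_self_of_mem R
    (gen_e₂_mem_spectatorSubalgebra R e₁ e₂ h12 _)

/-- The `Λᶜ` fields are fixed: `Ψ̄_{Λᶜ}(i) ↦ Ψ̄_{Λᶜ}(i)`. [cite: Dimock2002QED3TorusI, App. C p.66 L11–12] -/
theorem shiftΛ_fieldBar_inr (h12 : ∀ k k', e₁ k ≠ e₂ k') (i : κ') :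
    shiftΛ R e₁ e₂ T (fieldBar R e₁ e₂ (Sum.inr i)) = fieldBar R e₁ e₂ (Sum.inr i) :=
  (isSpectatorShift_meanShift R e₁ e₂ T h12).map_eq_self_of_mem R
    (gen_e₂_mem_spectatorSubalgebra R e₁ e₂ h12 _)

/-- Spectators of the `Λ`-variables (functions `H(Ψ̄_{Λᶜ},Ψ_{Λᶜ})`) are fixed by the transformation.
[cite: Dimock2002QED3TorusI, App. C (324) p.65 L65–74, p.66 L11–12] -/
theorem shiftΛ_eq_self_of_mem (h12 : ∀ k k', e₁ k ≠ e₂ k') {H : GrassmannAlgebra R J}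
    (hH : H ∈ spectatorSubalgebra R (varsΛ e₁)) : shiftΛ R e₁ e₂ T H = H :=
  (isSpectatorShift_meanShift R e₁ e₂ T h12).map_eq_self_of_mem R hH

/-- The transformation on `Ψ̄` in matrix form: `Ψ̄(x) ↦ Σ_p U_{px} Ψ̄(p)` with `U = (1 0; −T_{ΛᶜΛ}T_Λ⁻¹ 1)`.
[cite: Dimock2002QED3TorusI, App. C p.66 L9–12] -/
theorem shiftΛ_fieldBar_eq_sum (h12 : ∀ k k', e₁ k ≠ e₂ k') (x : κ ⊕ κ') :
    shiftΛ R e₁ e₂ T (fieldBar R e₁ e₂ x) =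
      ∑ p, (Matrix.fromBlocks 1 0 (-(T.toBlocks₂₁ * T.toBlocks₁₁⁻¹)) 1 : Matrix (κ ⊕ κ') (κ ⊕ κ') R) p x •
        fieldBar R e₁ e₂ p := by
  rcases x with i | i
  · rw [shiftΛ_fieldBar_inl, Fintype.sum_sum_type]
    simp only [Matrix.fromBlocks_apply₁₁, Matrix.fromBlocks_apply₂₁, Matrix.one_apply, ite_smul, one_smul,
      zero_smul, Finset.sum_ite_eq', Finset.mem_univ, if_true, Matrix.neg_apply, neg_smul,
      Finset.sum_neg_distrib, sub_eq_add_neg]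
  · rw [shiftΛ_fieldBar_inr R e₁ e₂ T h12, Fintype.sum_sum_type]
    simp only [Matrix.fromBlocks_apply₁₂, Matrix.fromBlocks_apply₂₂, Matrix.one_apply, ite_smul, one_smul,
      zero_smul, Finset.sum_ite_eq', Finset.mem_univ, if_true, Matrix.zero_apply, Finset.sum_const_zero,
      zero_add]

/-- The transformation on `Ψ` in matrix form: `Ψ(y) ↦ Σ_q V_{yq} Ψ(q)` with `V = (1 −T_Λ⁻¹T_{ΛΛᶜ}; 0 1)`.
[cite: Dimock2002QED3TorusI, App. C p.66 L6–12] -/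
theorem shiftΛ_field_eq_sum (h12 : ∀ k k', e₁ k ≠ e₂ k') (y : κ ⊕ κ') :
    shiftΛ R e₁ e₂ T (field R e₁ e₂ y) =
      ∑ q, (Matrix.fromBlocks 1 (-(T.toBlocks₁₁⁻¹ * T.toBlocks₁₂)) 0 1 : Matrix (κ ⊕ κ') (κ ⊕ κ') R) y q •
        field R e₁ e₂ q := by
  rcases y with j | j
  · rw [shiftΛ_field_inl, Fintype.sum_sum_type]
    simp only [Matrix.fromBlocks_apply₁₁, Matrix.fromBlocks_apply₁₂, Matrix.one_apply, ite_smul, one_smul,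
      zero_smul, Finset.sum_ite_eq, Finset.mem_univ, if_true, Matrix.neg_apply, neg_smul,
      Finset.sum_neg_distrib, sub_eq_add_neg]
  · rw [shiftΛ_field_inr R e₁ e₂ T h12, Fintype.sum_sum_type]
    simp only [Matrix.fromBlocks_apply₂₁, Matrix.fromBlocks_apply₂₂, Matrix.one_apply, ite_smul, one_smul,
      zero_smul, Finset.sum_ite_eq, Finset.mem_univ, if_true, Matrix.zero_apply, Finset.sum_const_zero,
      zero_add]

omit [Fintype J] in
/-- Substituting `Ψ̄(x) = Σ_p U_{px} Ψ̄'(p)` in a bilinear: `Σ T_{xy} Ψ̄(x)Φ(y) = Σ_{p,y} (UT)_{py} Ψ̄'(p)Φ(y)`.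
[folklore] -/
private theorem sum_sum_smul_subst_left (M U : Matrix (κ ⊕ κ') (κ ⊕ κ') R) (Φb Φ : κ ⊕ κ' → GrassmannAlgebra R J)
    (hb : ∀ x, Φb x = ∑ p, U p x • fieldBar R e₁ e₂ p) :
    ∑ x, ∑ y, M x y • (Φb x * Φ y) = ∑ p, ∑ y, (U * M) p y • (fieldBar R e₁ e₂ p * Φ y) := by
  simp only [hb, Finset.sum_mul, Finset.smul_sum, smul_mul_assoc, smul_smul, Matrix.mul_apply, Finset.sum_smul]
  calc ∑ x, ∑ y, ∑ p, (M x y * U p x) • (fieldBar R e₁ e₂ p * Φ y)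
      = ∑ y, ∑ x, ∑ p, (M x y * U p x) • (fieldBar R e₁ e₂ p * Φ y) := Finset.sum_comm
    _ = ∑ y, ∑ p, ∑ x, (M x y * U p x) • (fieldBar R e₁ e₂ p * Φ y) :=
        Finset.sum_congr rfl fun _ _ => Finset.sum_comm
    _ = ∑ p, ∑ y, ∑ x, (M x y * U p x) • (fieldBar R e₁ e₂ p * Φ y) := Finset.sum_comm
    _ = ∑ p, ∑ y, ∑ x, (U p x * M x y) • (fieldBar R e₁ e₂ p * Φ y) := by
        simp only [mul_comm (M _ _)]

omit [Fintype J] in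
/-- Substituting `Ψ(y) = Σ_q V_{yq} Ψ'(q)` in a bilinear: `Σ M_{py} Ψ̄(p)Ψ(y) = Σ_{p,q} (MV)_{pq} Ψ̄(p)Ψ'(q)`.
[folklore] -/
private theorem sum_sum_smul_subst_right (M V : Matrix (κ ⊕ κ') (κ ⊕ κ') R) (Φ : κ ⊕ κ' → GrassmannAlgebra R J)
    (h : ∀ y, Φ y = ∑ q, V y q • field R e₁ e₂ q) :
    ∑ p, ∑ y, M p y • (fieldBar R e₁ e₂ p * Φ y) = pairing R e₁ e₂ (M * V) := by
  simp only [h, pairing, Finset.mul_sum, Finset.smul_sum, mul_smul_comm, smul_smul, Matrix.mul_apply,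
    Finset.sum_smul]
  exact Finset.sum_congr rfl fun _ _ => Finset.sum_comm

/-- The block identity behind the completion of the square:
`(1 0; −T_{ΛᶜΛ}T_Λ⁻¹ 1) · T · (1 −T_Λ⁻¹T_{ΛΛᶜ}; 0 1) = (T_Λ 0; 0 R_{Λᶜ})` for `T_Λ` non-singular.
[cite: Dimock2002QED3TorusI, App. C p.65 L36–53 («The cross terms are eliminated by the transformation …»)] -/
theorem fromBlocks_conj_eq (hT : IsUnit T.toBlocks₁₁.det) :
    Matrix.fromBlocks 1 0 (-(T.toBlocks₂₁ * T.toBlocks₁₁⁻¹)) 1 * T *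
        Matrix.fromBlocks 1 (-(T.toBlocks₁₁⁻¹ * T.toBlocks₁₂)) 0 1 =
      Matrix.fromBlocks T.toBlocks₁₁ 0 0 (schur R T) := by
  rw [schur]
  set A := T.toBlocks₁₁
  set B := T.toBlocks₁₂
  set C := T.toBlocks₂₁
  set D := T.toBlocks₂₂
  rw [show T = Matrix.fromBlocks A B C D from (Matrix.fromBlocks_toBlocks T).symm]
  have h1 : A * A⁻¹ = 1 := Matrix.mul_nonsing_inv A hT
  have h2 : A⁻¹ * A = 1 := Matrix.nonsing_inv_mul A hT
  have hAAB : A * (A⁻¹ * B) = B := by rw [← Matrix.mul_assoc, h1, Matrix.one_mul]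
  have hCAA : C * A⁻¹ * A = C := by rw [Matrix.mul_assoc, h2, Matrix.mul_one]
  rw [Matrix.fromBlocks_multiply, Matrix.fromBlocks_multiply, Matrix.fromBlocks_inj]
  refine ⟨?_, ?_, ?_, ?_⟩
  · rw [Matrix.one_mul, Matrix.zero_mul, add_zero, Matrix.one_mul, Matrix.zero_mul, add_zero, Matrix.mul_one,
      Matrix.mul_zero, add_zero]
  · rw [Matrix.one_mul, Matrix.zero_mul, add_zero, Matrix.one_mul, Matrix.zero_mul, add_zero, Matrix.mul_neg,
      hAAB, Matrix.mul_one, neg_add_cancel]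
  · rw [Matrix.neg_mul, hCAA, Matrix.one_mul, neg_add_cancel, Matrix.zero_mul, Matrix.mul_zero, add_zero]
  · rw [Matrix.neg_mul, hCAA, Matrix.one_mul, neg_add_cancel, Matrix.zero_mul, zero_add, Matrix.one_mul,
      Matrix.mul_one, Matrix.neg_mul, neg_add_eq_sub]

/-- **The cross terms are eliminated**: under `Ψ_Λ → Ψ_Λ + β_Λ`, `Ψ̄_Λ → Ψ̄_Λ + β̄_Λ`,
`(Ψ̄, TΨ) ↦ (Ψ̄_Λ, T_ΛΨ_Λ) + (Ψ̄_{Λᶜ}, R_{Λᶜ}Ψ_{Λᶜ})` with `R_{Λᶜ} = T_{Λᶜ} − T_{ΛᶜΛ}T_Λ⁻¹T_{ΛΛᶜ}`.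
[cite: Dimock2002QED3TorusI, App. C p.65 L36–53, p.66 L11–12] -/
theorem shiftΛ_pairing (h12 : ∀ k k', e₁ k ≠ e₂ k') (hT : IsUnit T.toBlocks₁₁.det) :
    shiftΛ R e₁ e₂ T (pairing R e₁ e₂ T) =
      ExteriorAlgebra.map (Function.ExtendByZero.linearMap R e₁) (quadratic R T.toBlocks₁₁) +
        ∑ i, ∑ j, schur R T i j • (fieldBar R e₁ e₂ (Sum.inr i) * field R e₁ e₂ (Sum.inr j)) := by
  have h : shiftΛ R e₁ e₂ T (pairing R e₁ e₂ T) =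
      ∑ x, ∑ y, T x y • (shiftΛ R e₁ e₂ T (fieldBar R e₁ e₂ x) * shiftΛ R e₁ e₂ T (field R e₁ e₂ y)) := by
    simp only [pairing, map_sum, map_smul, map_mul]
  rw [h, sum_sum_smul_subst_left R e₁ e₂ T _ _ _ (shiftΛ_fieldBar_eq_sum R e₁ e₂ T h12),
    sum_sum_smul_subst_right R e₁ e₂ _ _ _ (shiftΛ_field_eq_sum R e₁ e₂ T h12), fromBlocks_conj_eq R T hT,
    pairing_fromBlocks_diag, sum_sum_toBlocks₁₁_eq_map_quadratic]

end Shift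

/-! ## The `Λ`-Gaussian weight `exp(−(Ψ̄, T_ΛΨ))` and its integral -/

section Weight

variable [Algebra ℚ R] (e₁ : κ ⊕ₗ κ ↪o J) (e₂ : κ' ⊕ₗ κ' ↪o J)

/-- The weight `exp(−(Ψ̄, T_ΛΨ))` of the `Λ`-variables in the big algebra (the tree's `e^{ψ̄(−T_Λ)ψ}` transported
along `e₁`). [cite: Dimock2002QED3TorusI, App. C (326) p.66 L13–24] -/
def weightΛ (A : Matrix κ κ R) : GrassmannAlgebra R J :=
  ExteriorAlgebra.map (Function.ExtendByZero.linearMap R e₁) (grassmannExp (-quadratic R A))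

variable {R} in
/-- The denominator of (326): `∫ exp(−(Ψ̄, T_ΛΨ)) dΨ̄_Λ dΨ_Λ`, the Berezin integral over the `Λ`-variables (tree
orientation `∫ ψ̄₁⋯ψ̄ₙψ₁⋯ψₙ = 1`). [cite: Dimock2002QED3TorusI, App. C (326) p.66 L19–26] -/
def gaussNormΛ (A : Matrix κ κ R) : R :=
  berezin R (κ ⊕ₗ κ) (grassmannExp (-quadratic R A))

omit [Algebra ℚ R] in
/-- `ψ̄(−A)ψ = −ψ̄Aψ`. [folklore] -/
private theorem quadratic_neg (A : Matrix κ κ R) : quadratic R (-A) = -quadratic R A := by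
  simp only [quadratic, Matrix.neg_apply, neg_smul, Finset.sum_neg_distrib]

omit [Fintype J] in
/-- `exp(−(Ψ̄, T_ΛΨ))` written out in the big algebra. [cite: Dimock2002QED3TorusI, App. C (326) p.66 L15–18] -/
theorem weightΛ_eq_grassmannExp (A : Matrix κ κ R) :
    weightΛ R e₁ A = grassmannExp (-∑ i, ∑ j, A i j •
      (gen R (e₁ (toLex (Sum.inl i))) * gen R (e₁ (toLex (Sum.inr j))))) := by
  rw [weightΛ, grassmannExp, IsNilpotent.map_exp (isNilpotent_quadratic R A).neg, map_neg]
  simp only [quadratic, map_sum, map_smul, map_mul, psiBar, psi, map_extendByZero_gen']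
  rfl

/-- `∫ exp(−(Ψ̄,T_ΛΨ)) dΨ̄_ΛdΨ_Λ = (−1)^{n(n−1)/2} det(−T_Λ) = (−1)^{n(n+1)/2} det T_Λ`, `n = |Λ|` (the tree's
Gaussian Berezin integral `berezin_grassmannExp_quadratic`). [cite: Dimock2002QED3TorusI, App. C (326) p.66 L19–26] -/
theorem gaussNormΛ_eq (A : Matrix κ κ R) :
    gaussNormΛ A = (-1 : R) ^ (Fintype.card κ * (Fintype.card κ - 1) / 2) * (-A).det := by
  rw [gaussNormΛ, ← quadratic_neg, berezin_grassmannExp_quadratic_holds R (-A)]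

/-- *"The denominator is non-zero by the assumption that `T_Λ` is non-singular"* — and conversely.
[cite: Dimock2002QED3TorusI, App. C p.66 L26] -/
theorem isUnit_gaussNormΛ_iff (A : Matrix κ κ R) : IsUnit (gaussNormΛ A) ↔ IsUnit A.det := by
  rw [gaussNormΛ_eq, Matrix.det_neg, ← mul_assoc, IsUnit.mul_iff]
  have hu : IsUnit ((-1 : R) ^ (Fintype.card κ * (Fintype.card κ - 1) / 2) * (-1) ^ Fintype.card κ) :=
    ((isUnit_one.neg).pow _).mul ((isUnit_one.neg).pow _)
  exact ⟨fun h => h.2, fun h => ⟨hu, h⟩⟩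

/-- `∫ dΨ̄_ΛdΨ_Λ exp(−(Ψ̄, T_ΛΨ)) = (∫ exp(−(Ψ̄,T_ΛΨ)) dΨ̄_ΛdΨ_Λ) · 1` in the big algebra (transport along `e₁`): the
denominator of (326). [cite: Dimock2002QED3TorusI, App. C (326) p.66 L19–24] -/
theorem berezinOn_varsΛ_weightΛ (A : Matrix κ κ R) :
    berezinOn R (varsΛ e₁) (weightΛ R e₁ A) = algebraMap R (GrassmannAlgebra R J) (gaussNormΛ A) :=
  berezinOn_map_extendByZero R e₁ _

omit [Fintype J] in
/-- The weight `exp(−(Ψ̄, T_ΛΨ))` is central. [cite: Dimock2002QED3TorusI, App. C (326) p.66 L15–18] -/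
theorem commute_weightΛ (A : Matrix κ κ R) (z : GrassmannAlgebra R J) : Commute (weightΛ R e₁ A) z := by
  rw [weightΛ_eq_grassmannExp R e₁]
  have hc := commute_sum_sum_smul_ι_mul_ι A (fun i => (Pi.single (e₁ (toLex (Sum.inl i))) (1 : R) : J → R))
    (fun j => (Pi.single (e₁ (toLex (Sum.inr j))) (1 : R) : J → R))
  have hn := isNilpotent_sum_sum_smul_ι_mul_ι A (fun i => (Pi.single (e₁ (toLex (Sum.inl i))) (1 : R) : J → R))
    (fun j => (Pi.single (e₁ (toLex (Sum.inr j))) (1 : R) : J → R))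
  exact commute_exp_of_forall_commute (fun z => (hc z).neg_left) hn.neg z

end Weight

/-! ## `F̃` — (325) as defined by (326) -/

section CondExp

variable [Algebra ℚ R] (e₁ : κ ⊕ₗ κ ↪o J) (e₂ : κ' ⊕ₗ κ' ↪o J) (T : Matrix (κ ⊕ κ') (κ ⊕ κ') R)

/-- **`F̃(Ψ̄_{Λᶜ},Ψ_{Λᶜ})`** — *"the Gaussian integral over `Ψ̄_Λ, Ψ_Λ` with covariance `Γ_Λ = T_Λ⁻¹` and mean
`β_Λ = −T_Λ⁻¹T_{ΛΛᶜ}Ψ_{Λᶜ}` and `β̄_Λ = −(T_Λ⁻¹)ᵀ(T_{ΛᶜΛ})ᵀΨ̄_{Λᶜ}`"* (325), **as defined by (326)**: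
`F̃ = ∫ F(Ψ̄ + β̄_Λ, Ψ + β_Λ) exp(−(Ψ̄,T_ΛΨ)) dΨ̄_ΛdΨ_Λ ∕ ∫ exp(−(Ψ̄,T_ΛΨ)) dΨ̄_ΛdΨ_Λ` (`Ring.inverse` of the
denominator; for singular `T_Λ` the junk value `0`). [cite: Dimock2002QED3TorusI, App. C (325)–(326) p.66 L1–26] -/
def condExp (F : GrassmannAlgebra R J) : GrassmannAlgebra R J :=
  Ring.inverse (gaussNormΛ T.toBlocks₁₁) •
    berezinOn R (varsΛ e₁) (shiftΛ R e₁ e₂ T F * weightΛ R e₁ T.toBlocks₁₁)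

/-- `F̃ = F̃(Ψ̄_{Λᶜ},Ψ_{Λᶜ})` does not involve the `Λ`-variables. [cite: Dimock2002QED3TorusI, App. C (325) p.66 L2] -/
theorem condExp_mem_spectatorSubalgebra (F : GrassmannAlgebra R J) :
    condExp R e₁ e₂ T F ∈ spectatorSubalgebra R (varsΛ e₁) :=
  Subalgebra.smul_mem _ (berezinOn_mem_spectatorSubalgebra_self R _ _) _

/-- `F̃` is additive in `F` (linearity of the Gaussian integral (325)). [cite: Dimock2002QED3TorusI, App. C (325) p.66 L2–6] -/
theorem condExp_add (F G : GrassmannAlgebra R J) :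
    condExp R e₁ e₂ T (F + G) = condExp R e₁ e₂ T F + condExp R e₁ e₂ T G := by
  simp only [condExp, map_add, add_mul, smul_add]

/-- `F̃` is homogeneous in `F` (linearity of the Gaussian integral (325)). [cite: Dimock2002QED3TorusI, App. C (325) p.66 L2–6] -/
theorem condExp_smul (r : R) (F : GrassmannAlgebra R J) :
    condExp R e₁ e₂ T (r • F) = r • condExp R e₁ e₂ T F := by
  simp only [condExp, map_smul, smul_mul_assoc, smul_comm r]

/-- `F̃` is linear over the functions of the `Λᶜ` fields: `(H F)~ = H F̃` for `H = H(Ψ̄_{Λᶜ},Ψ_{Λᶜ})` (the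
conditional-expectation property, Remark p.65 L33–34). [cite: Dimock2002QED3TorusI, App. C p.65 L33–34] -/
theorem condExp_spectator_mul (h12 : ∀ k k', e₁ k ≠ e₂ k') {H : GrassmannAlgebra R J}
    (hH : H ∈ spectatorSubalgebra R (varsΛ e₁)) (F : GrassmannAlgebra R J) :
    condExp R e₁ e₂ T (H * F) = H * condExp R e₁ e₂ T F := by
  rw [condExp, condExp, map_mul (shiftΛ R e₁ e₂ T), shiftΛ_eq_self_of_mem R e₁ e₂ T h12 hH, mul_assoc,
    berezinOn_mul_of_mem_spectatorSubalgebra R hH, mul_smul_comm]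

/-- `1̃ = 1` for non-singular `T_Λ` (numerator = denominator in (326)). [cite: Dimock2002QED3TorusI, App. C (326) p.66 L13–26] -/
theorem condExp_one (hT : IsUnit T.toBlocks₁₁.det) : condExp R e₁ e₂ T 1 = 1 := by
  rw [condExp, map_one, one_mul, berezinOn_varsΛ_weightΛ, Algebra.algebraMap_eq_smul_one, smul_smul,
    Ring.inverse_mul_cancel _ ((isUnit_gaussNormΛ_iff R _).2 hT), one_smul]

end CondExp

/-! ## LEMMA 24 -/

section Lemma24

variable [Algebra ℚ R] (e₁ : κ ⊕ₗ κ ↪o J) (e₂ : κ' ⊕ₗ κ' ↪o J) (T : Matrix (κ ⊕ κ') (κ ⊕ κ') R)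

/-- The weight transforms as `exp(−(Ψ̄,TΨ)) ↦ exp(−(Ψ̄,T_ΛΨ)) · exp(−(Ψ̄_{Λᶜ},R_{Λᶜ}Ψ_{Λᶜ}))`.
[cite: Dimock2002QED3TorusI, App. C (322) p.65 L39–53] -/
theorem shiftΛ_grassmannExp_neg_pairing (h12 : ∀ k k', e₁ k ≠ e₂ k') (hT : IsUnit T.toBlocks₁₁.det) :
    shiftΛ R e₁ e₂ T (grassmannExp (-pairing R e₁ e₂ T)) =
      weightΛ R e₁ T.toBlocks₁₁ *
        grassmannExp (-∑ i, ∑ j, schur R T i j • (fieldBar R e₁ e₂ (Sum.inr i) * field R e₁ e₂ (Sum.inr j))) := by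
  have hn : IsNilpotent (pairing R e₁ e₂ T) := isNilpotent_pairing R e₁ e₂ T
  rw [grassmannExp, shiftΛ, IsNilpotent.map_exp hn.neg, map_neg, ← shiftΛ, shiftΛ_pairing R e₁ e₂ T h12 hT,
    neg_add, weightΛ, grassmannExp, IsNilpotent.map_exp (isNilpotent_quadratic R _).neg, map_neg, grassmannExp]
  refine IsNilpotent.exp_add_of_commute ?_ ((isNilpotent_quadratic R _).map _).neg
    (isNilpotent_sum_sum_inr R e₁ e₂ _).neg
  exact ((commute_sum_sum_inr R e₁ e₂ (schur R T) _).symm).neg_left.neg_right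

/-- The common value of the `dΨ̄_ΛdΨ_Λ` integrals: for a spectator `H` and any `G`,
`∫ dΨ̄_ΛdΨ_Λ [H G e^{−(Ψ̄,TΨ)}] = H · ∫ dΨ̄_ΛdΨ_Λ [G(Ψ̄+β̄_Λ,Ψ+β_Λ) e^{−(Ψ̄,T_ΛΨ)}] · e^{−(Ψ̄_{Λᶜ},R_{Λᶜ}Ψ_{Λᶜ})}`.
[cite: Dimock2002QED3TorusI, App. C (322)–(323) p.65 L39–61] -/
theorem berezinOn_varsΛ_mul_mul_grassmannExp (h12 : ∀ k k', e₁ k ≠ e₂ k') (hT : IsUnit T.toBlocks₁₁.det)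
    {H : GrassmannAlgebra R J} (hH : H ∈ spectatorSubalgebra R (varsΛ e₁)) (G : GrassmannAlgebra R J) :
    berezinOn R (varsΛ e₁) (H * G * grassmannExp (-pairing R e₁ e₂ T)) =
      H * berezinOn R (varsΛ e₁) (shiftΛ R e₁ e₂ T G * weightΛ R e₁ T.toBlocks₁₁) *
        grassmannExp (-∑ i, ∑ j, schur R T i j • (fieldBar R e₁ e₂ (Sum.inr i) * field R e₁ e₂ (Sum.inr j))) := by
  set ER := grassmannExp (-∑ i, ∑ j, schur R T i j • (fieldBar R e₁ e₂ (Sum.inr i) * field R e₁ e₂ (Sum.inr j)))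
    with hER
  have hshift := isSpectatorShift_meanShift R e₁ e₂ T h12
  have hERspec : ER ∈ spectatorSubalgebra R (varsΛ e₁) :=
    exp_mem_of_mem (Subalgebra.neg_mem _ (sum_sum_inr_mem_spectatorSubalgebra R e₁ e₂ h12 _))
      (isNilpotent_sum_sum_inr R e₁ e₂ _).neg
  have hERc : ∀ z, Commute ER z :=
    commute_exp_of_forall_commute (fun z => (commute_sum_sum_inr R e₁ e₂ (schur R T) z).neg_left)
      (isNilpotent_sum_sum_inr R e₁ e₂ _).neg
  rw [← hshift.berezinOn_map R (H * G * _)]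
  change berezinOn R (varsΛ e₁) (shiftΛ R e₁ e₂ T (H * G * grassmannExp (-pairing R e₁ e₂ T))) = _
  rw [map_mul (shiftΛ R e₁ e₂ T), map_mul (shiftΛ R e₁ e₂ T), shiftΛ_eq_self_of_mem R e₁ e₂ T h12 hH,
    shiftΛ_grassmannExp_neg_pairing R e₁ e₂ T h12 hT,
    ← hER, ← mul_assoc, berezinOn_mul_of_mem_spectatorSubalgebra_of_commute R hERspec hERc, mul_assoc H,
    berezinOn_mul_of_mem_spectatorSubalgebra R hH]

/-- **LEMMA 24, at the level of the `Λ`-integration** (an identity in the algebra of the `Λᶜ` fields): for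
`H = H(Ψ̄_{Λᶜ},Ψ_{Λᶜ})`, any `F`, and `T_Λ` non-singular,
`∫ dΨ̄_ΛdΨ_Λ [H F e^{−(Ψ̄,TΨ)}] = ∫ dΨ̄_ΛdΨ_Λ [H F̃ e^{−(Ψ̄,TΨ)}]`.
[cite: Dimock2002QED3TorusI, App. C LEMMA 24 (324)–(326) p.65 L62 – p.66 L26] -/
theorem berezinOn_varsΛ_mul_condExp (h12 : ∀ k k', e₁ k ≠ e₂ k') (hT : IsUnit T.toBlocks₁₁.det)
    {H : GrassmannAlgebra R J} (hH : H ∈ spectatorSubalgebra R (varsΛ e₁)) (F : GrassmannAlgebra R J) :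
    berezinOn R (varsΛ e₁) (H * F * grassmannExp (-pairing R e₁ e₂ T)) =
      berezinOn R (varsΛ e₁) (H * condExp R e₁ e₂ T F * grassmannExp (-pairing R e₁ e₂ T)) := by
  have hc : IsUnit (gaussNormΛ T.toBlocks₁₁) := (isUnit_gaussNormΛ_iff R _).2 hT
  rw [berezinOn_varsΛ_mul_mul_grassmannExp R e₁ e₂ T h12 hT hH,
    berezinOn_varsΛ_mul_mul_grassmannExp R e₁ e₂ T h12 hT hH,
    shiftΛ_eq_self_of_mem R e₁ e₂ T h12 (condExp_mem_spectatorSubalgebra R e₁ e₂ T F),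
    berezinOn_mul_of_mem_spectatorSubalgebra R (condExp_mem_spectatorSubalgebra R e₁ e₂ T F),
    berezinOn_varsΛ_weightΛ, ← Algebra.commutes, ← Algebra.smul_def, condExp, smul_smul,
    Ring.mul_inverse_cancel _ hc, one_smul]

omit [Fintype J] [Algebra ℚ R] in
/-- The shuffle sign of Fubini squares to one. [folklore] -/
private theorem intCast_berezinSign_mul_self (s t : Finset J) :
    ((((berezinSign s t : ℤˣ) : ℤ) : R)) * (((berezinSign s t : ℤˣ) : ℤ) : R) = 1 := by
  rw [intCast_berezinSign, ← mul_pow, neg_one_mul, neg_neg, one_pow]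

/-- **LEMMA 24, integrated over any set of variables containing those of `Λ`** (e.g. all of `Ψ̄, Ψ`): for
`H = H(Ψ̄_{Λᶜ},Ψ_{Λᶜ})`, any `F`, `T_Λ` non-singular and `varsΛ ⊆ t`,
`∫ dθ_t [H F e^{−(Ψ̄,TΨ)}] = ∫ dθ_t [H F̃ e^{−(Ψ̄,TΨ)}]`.
[cite: Dimock2002QED3TorusI, App. C LEMMA 24 (324) p.65 L65–79] -/
theorem berezinOn_mul_condExp (h12 : ∀ k k', e₁ k ≠ e₂ k') (hT : IsUnit T.toBlocks₁₁.det)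
    {t : Finset J} (ht : varsΛ e₁ ⊆ t)
    {H : GrassmannAlgebra R J} (hH : H ∈ spectatorSubalgebra R (varsΛ e₁)) (F : GrassmannAlgebra R J) :
    berezinOn R t (H * F * grassmannExp (-pairing R e₁ e₂ T)) =
      berezinOn R t (H * condExp R e₁ e₂ T F * grassmannExp (-pairing R e₁ e₂ T)) := by
  have hdisj : Disjoint (t \ varsΛ e₁) (varsΛ e₁) := Finset.sdiff_disjoint
  have hunion : t \ varsΛ e₁ ∪ varsΛ e₁ = t := Finset.sdiff_union_of_subset ht
  have key := berezinOn_varsΛ_mul_condExp R e₁ e₂ T h12 hT hH F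
  have h1 := berezinOn_berezinOn R hdisj (H * F * grassmannExp (-pairing R e₁ e₂ T))
  have h2 := berezinOn_berezinOn R hdisj (H * condExp R e₁ e₂ T F * grassmannExp (-pairing R e₁ e₂ T))
  rw [hunion] at h1 h2
  rw [key, h2] at h1
  have h3 := congrArg (fun z => (((berezinSign (varsΛ e₁) t : ℤˣ) : ℤ) : R) • z) h1
  simp only [smul_smul, intCast_berezinSign_mul_self, one_smul] at h3
  exact h3.symm

/-- **LEMMA 24 (324) as printed**: for Grassmann variables `Ψ̄, Ψ` indexed by `S = Λ ⊔ Λᶜ`, an operator `T` on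
`R^S` with `T_Λ = χ_ΛTχ_Λ` non-singular, every `H = H(Ψ̄_{Λᶜ},Ψ_{Λᶜ})` and every `F = F(Ψ̄,Ψ)`,
`∫ H(Ψ̄_{Λᶜ},Ψ_{Λᶜ}) F(Ψ̄,Ψ) exp(−(Ψ̄,TΨ)) dΨ̄dΨ = ∫ H(Ψ̄_{Λᶜ},Ψ_{Λᶜ}) F̃(Ψ̄_{Λᶜ},Ψ_{Λᶜ}) exp(−(Ψ̄,TΨ)) dΨ̄dΨ`
with `F̃` given by (325)∕(326) (`condExp`). [cite: Dimock2002QED3TorusI, App. C LEMMA 24 (324)–(326) p.65 L62 – p.66 L26] -/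
theorem berezin_mul_condExp (h12 : ∀ k k', e₁ k ≠ e₂ k') (hT : IsUnit T.toBlocks₁₁.det)
    {H : GrassmannAlgebra R J} (hH : H ∈ spectatorSubalgebra R (varsΛ e₁)) (F : GrassmannAlgebra R J) :
    berezin R J (H * F * grassmannExp (-pairing R e₁ e₂ T)) =
      berezin R J (H * condExp R e₁ e₂ T F * grassmannExp (-pairing R e₁ e₂ T)) := by
  have h := berezinOn_mul_condExp R e₁ e₂ T h12 hT (Finset.subset_univ _) hH F
  rw [berezinOn_univ_holds, berezinOn_univ_holds] at h
  exact (ExteriorAlgebra.algebraMap_inj _ _ _).1 h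

/-- (324) with `H = 1`: `∫ F e^{−(Ψ̄,TΨ)} dΨ̄dΨ = ∫ F̃ e^{−(Ψ̄,TΨ)} dΨ̄dΨ`.
[cite: Dimock2002QED3TorusI, App. C LEMMA 24 (324) p.65 L65–79] -/
theorem berezin_condExp (h12 : ∀ k k', e₁ k ≠ e₂ k') (hT : IsUnit T.toBlocks₁₁.det) (F : GrassmannAlgebra R J) :
    berezin R J (F * grassmannExp (-pairing R e₁ e₂ T)) =
      berezin R J (condExp R e₁ e₂ T F * grassmannExp (-pairing R e₁ e₂ T)) := by
  simpa only [one_mul] using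
    berezin_mul_condExp R e₁ e₂ T h12 hT (Subalgebra.one_mem (spectatorSubalgebra R (varsΛ e₁))) F

end Lemma24

end SpacetimeSplit

end QED3TorusI

end Literature.MathematicalPhysics.QuantumFieldTheory.Dimock2011to13
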